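import Literature.Probability.Percolation.FiniteClustersPercolationOneArm
import HarnessLib

/-!
# Crux `PercBurnResprinkle.VacantSetPercolates` (stmt-CriticalPhenomena-7205), line `planar-armed-sections` — stub `stub_coarseFootprint`

Helper file for the crux skeleton of the line `planar-armed-sections` (lead
prover-line-stmt-CriticalPhenomena-7205-0).  Proves exactly the registered stub signature
`stub_coarseFootprint` (`CoarseLocality → CoarseFootprint`); lands with
`--supports stmt-CriticalPhenomena-7205`.

## The statement (finite-dependence geometry of the coarse process)

Scales `n, N` with `2n < N`.  The coarse (renormalised) bond configuration `BC n N ω` on `ℤ²` declares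
the pair `{a, a + e_k}` open iff the `2N × N` block rectangle of `a` in direction `k` and, for the
transverse direction `j ≠ k`, the block rectangles of `a` and of `a + e_k` in direction `j` are crossed the
long way by lattice paths of `ℤ²` through sites `w` with `planeEmb 3 w` quiet at scale `n`.
HYPOTHESIS (locality; the neighbouring stub `stub_coarseLocality`): each crossing event `QX n N c i` is
determined by its footprint `FP n N c i = ⋃_{w ∈ rectangle} armPairs (planeEmb 3 w) n`, a finite set of
pairs of `ℤ³`.  CONCLUSION: there is a footprint `FPT e` for every unordered pair `e` of coarse sites
which (i) determines `{ω | e ∈ BC n N ω}`, (ii) is finite, (iii) is disjoint from `FPT e'` as soon as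
every member of `e` is at sup-distance `≥ 5` from every member of `e'`.

## The argument

Take `FPT e := ⋃_{c ∈ e} ⋃_i FP n N c i` — the footprints of both block rectangles of both members of
`e` (a superset of the three rectangles read by the edge event, harmless since `DeterminedBy` is monotone
in the footprint).  (i): configurations agreeing on `FPT e` agree on every `FP n N c i`, `c ∈ e`, hence
(locality) on every event `QX n N c i`, `c ∈ e`, and `{ω | e ∈ BC n N ω}` is a Boolean combination of
these (`c ∈ {a, a + e_k}`, the two members of `e`).  (ii): `e` has at most two members and every `FP` is
finite.  (iii) (window arithmetic, exactly as `disjoint_coarsePairs` one dimension down): a site `w` of a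
block rectangle of `c` satisfies `N c_l ≤ w_l ≤ N c_l + 2N` in both coordinates; a common pair of
`armPairs (planeEmb 3 w₁) n` and `armPairs (planeEmb 3 w₂) n` forces `|w₁ l - w₂ l| ≤ 2n`
(`abs_sub_le_of_mem_box_sub`); members `c₁ ∈ e₁`, `c₂ ∈ e₂` with `|c₁ l - c₂ l| ≥ 5` would give
`|w₁ l - w₂ l| ≥ 5N - 2N = 3N > 2n`.

Sources: Grimmett–Holroyd–Kozma (2014), §4, proof of Thm. 5 ("3-dependent family of random variables");
Grimmett, *Percolation* (1999), §7.4 (static renormalisation).  Nothing probabilistic happens in this file.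
-/

noncomputable section

namespace Summit.CriticalPhenomena.PercolationContinuityZ3.Theorems

open MeasureTheory Set Literature.Probability.Percolation Literature.Probability.LatticeModels

namespace CoarseFootprint

/-- The member set of an unordered pair is finite (it is `{x, y}`). [folklore] -/
theorem finite_coe (e : Sym2 (Site 2)) : (e : Set (Site 2)).Finite := by
  induction e with
  | h x y => rw [Sym2.coe_mk]; exact Set.toFinite _

/-- **Window lemma.** A site `w` of the block rectangle of the coarse site `a` in direction `k`
(`N a_k ≤ w_k ≤ N a_k + 2N` and `N a_j ≤ w_j ≤ N a_j + N` for `j ≠ k`) lies in the `2N`-window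
`N a_l ≤ w_l ≤ N a_l + 2N` in both coordinates; hence every pair of the rectangle's footprint is an arm
pair (radius `n`) of a window site. [folklore] -/
theorem exists_window_of_mem_footprint (n N : ℕ) (a : Site 2) (k : Fin 2) (q : Sym2 (Site 3))
    (hq : q ∈ ⋃ w ∈ {w : Site 2 | ((N : ℤ) * a k ≤ w k ∧ w k ≤ (N : ℤ) * a k + 2 * (N : ℤ)) ∧
        ∀ j : Fin 2, j ≠ k → (N : ℤ) * a j ≤ w j ∧ w j ≤ (N : ℤ) * a j + (N : ℤ)},
      armPairs (planeEmb 3 w) n) :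
    ∃ w : Site 2, (∀ l : Fin 2, (N : ℤ) * a l ≤ w l ∧ w l ≤ (N : ℤ) * a l + 2 * (N : ℤ)) ∧
      q ∈ armPairs (planeEmb 3 w) n := by
  simp only [mem_iUnion, mem_setOf_eq, exists_prop] at hq
  obtain ⟨w, ⟨hk, hj⟩, hq⟩ := hq
  refine ⟨w, fun l => ?_, hq⟩
  by_cases hl : l = k
  · subst hl
    exact hk
  · have h := hj l hl
    have h0 : (0 : ℤ) ≤ N := by positivity
    exact ⟨h.1, by linarith [h.2]⟩

/-- **Finite-dependence geometry, abstract form.**  Let `Q c i` (`c ∈ ℤ²`, `i : Fin 2`) be events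
determined by finite footprints `F c i` all of whose pairs are arm pairs (radius `n`) of sites in the
`2N`-window of `c`, and let `2n < N`.  Then `FPT e := ⋃_{c ∈ e} ⋃_i F c i` determines the coarse edge
event `{ω | ∃ a k, e = {a, a + e_k} ∧ ω ∈ Q a k ∧ ∀ j ≠ k, ω ∈ Q a j ∧ ω ∈ Q (a + e_k) j}`, is finite, and
`FPT e₁`, `FPT e₂` are disjoint once the members of `e₁` and `e₂` are `≥ 5` apart in sup-distance
(`5N - 2N = 3N > 2n`).
[cite: GrimmettHolroydKozma2014, §4 (proof of Thm. 5, "3-dependent family of random variables")] -/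
theorem exists_footprint {n N : ℕ} {Q : Site 2 → Fin 2 → Set (BondConfig (Site 3))}
    {F : Site 2 → Fin 2 → Set (Sym2 (Site 3))}
    (hLoc : ∀ (a : Site 2) (k : Fin 2), DeterminedBy (Q a k) (F a k) ∧ (F a k).Finite)
    (hW : ∀ (a : Site 2) (k : Fin 2), ∀ q ∈ F a k, ∃ w : Site 2,
      (∀ l : Fin 2, (N : ℤ) * a l ≤ w l ∧ w l ≤ (N : ℤ) * a l + 2 * (N : ℤ)) ∧
        q ∈ armPairs (planeEmb 3 w) n)
    (hN : 2 * n < N) :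
    ∃ FPT : Sym2 (Site 2) → Set (Sym2 (Site 3)),
      (∀ e : Sym2 (Site 2), DeterminedBy {ω : BondConfig (Site 3) | ∃ (a : Site 2) (k : Fin 2),
          e = s(a, a + Pi.single k 1) ∧ ω ∈ Q a k ∧
            ∀ j : Fin 2, j ≠ k → ω ∈ Q a j ∧ ω ∈ Q (a + Pi.single k 1) j} (FPT e) ∧
        (FPT e).Finite) ∧
      ∀ e₁ e₂ : Sym2 (Site 2), (∀ b₁ ∈ e₁, ∀ b₂ ∈ e₂, ((5 : ℕ) : ℤ) ≤ max |b₁ 0 - b₂ 0| |b₁ 1 - b₂ 1|) →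
        Disjoint (FPT e₁) (FPT e₂) := by
  refine ⟨fun e => ⋃ c ∈ (e : Set (Site 2)), ⋃ i : Fin 2, F c i, fun e => ⟨?_, ?_⟩, ?_⟩
  · -- (i) the edge event is determined by the footprint
    rw [determinedBy_iff]
    intro ω ω' h
    have key : ∀ c : Site 2, c ∈ e → ∀ i : Fin 2, (ω ∈ Q c i ↔ ω' ∈ Q c i) := fun c hc i =>
      (determinedBy_iff _ _).1 (hLoc c i).1 ω ω' (inter_eq_inter_of_subset h fun q hq => by
        simp only [mem_iUnion, SetLike.mem_coe, exists_prop]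
        exact ⟨c, hc, i, hq⟩)
    simp only [mem_setOf_eq]
    refine exists_congr fun a => exists_congr fun k => and_congr_right fun he => ?_
    have ha : a ∈ e := by
      rw [he]
      exact Sym2.mem_mk_left _ _
    have ha' : a + Pi.single k 1 ∈ e := by
      rw [he]
      exact Sym2.mem_mk_right _ _
    exact and_congr (key a ha k)
      (forall₂_congr fun j _ => and_congr (key a ha j) (key _ ha' j))
  · -- (ii) the footprint is finite
    exact (finite_coe e).biUnion fun c _ => finite_iUnion fun i => (hLoc c i).2
  · -- (iii) separated coarse pairs have disjoint footprints
    intro e₁ e₂ hsep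
    rw [Set.disjoint_left]
    intro q h1 h2
    simp only [mem_iUnion, SetLike.mem_coe, exists_prop] at h1 h2
    obtain ⟨c₁, hc₁, i₁, hq₁⟩ := h1
    obtain ⟨c₂, hc₂, i₂, hq₂⟩ := h2
    obtain ⟨w₁, hw₁, hq₁⟩ := hW c₁ i₁ q hq₁
    obtain ⟨w₂, hw₂, hq₂⟩ := hW c₂ i₂ q hq₂
    obtain ⟨u, hu⟩ : ∃ u, u ∈ q := ⟨q.out.1, Sym2.out_fst_mem q⟩
    have hu₁ : u - planeEmb 3 w₁ ∈ box 3 n := Set.mem_sym2_iff_subset.1 hq₁ hu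
    have hu₂ : u - planeEmb 3 w₂ ∈ box 3 n := Set.mem_sym2_iff_subset.1 hq₂ hu
    obtain ⟨l, hl⟩ : ∃ l : Fin 2, (5 : ℤ) ≤ |c₁ l - c₂ l| := by
      have h5 := hsep c₁ hc₁ c₂ hc₂
      push_cast at h5
      rcases le_max_iff.1 h5 with h | h
      exacts [⟨0, h⟩, ⟨1, h⟩]
    obtain ⟨hb₁, hb₂⟩ := abs_le.1 (abs_sub_le_of_mem_box_sub (by norm_num : 2 ≤ 3) hu₁ hu₂ l)
    obtain ⟨h₁, h₁'⟩ := hw₁ l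
    obtain ⟨h₂, h₂'⟩ := hw₂ l
    have hN0 : (0 : ℤ) ≤ N := by positivity
    have hN' : (2 * n : ℤ) < N := by exact_mod_cast hN
    rw [le_abs] at hl
    rcases hl with hl | hl
    · have := mul_le_mul_of_nonneg_left hl hN0
      linarith
    · have := mul_le_mul_of_nonneg_left hl hN0
      linarith

end CoarseFootprint

/-- **Registered stub `stub_coarseFootprint`: `CoarseLocality → CoarseFootprint`** (finite-dependence
geometry of the planar renormalisation).  If every long-way quiet block-crossing event is determined by
its finite footprint (hypothesis), then for `2n < N` every unordered pair `e` of coarse sites has a finite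
footprint of pairs of `ℤ³` deciding whether `e` is an open coarse edge, and coarse pairs whose members
are `≥ 5` apart in sup-distance have disjoint footprints.  Proof: `CoarseFootprint.exists_footprint` with
the window lemma `CoarseFootprint.exists_window_of_mem_footprint`.
[cite: GrimmettHolroydKozma2014, §4 (proof of Thm. 5, "3-dependent family of random variables")] -/
theorem stub_coarseFootprint :
    (∀ (n N : ℕ) (a : Site 2) (k : Fin 2),
      DeterminedBy
        {ω : BondConfig (Site 3) | ∃ x y : Site 2, x k = (N : ℤ) * a k ∧ y k = (N : ℤ) * a k + 2 * (N : ℤ) ∧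
          PathIn (zdGraph 2) ({w : Site 2 | ((N : ℤ) * a k ≤ w k ∧ w k ≤ (N : ℤ) * a k + 2 * (N : ℤ)) ∧
            ∀ j : Fin 2, j ≠ k → (N : ℤ) * a j ≤ w j ∧ w j ≤ (N : ℤ) * a j + (N : ℤ)} ∩
            {w | planeEmb 3 w ∈ quietSet n ω}) x y}
        (⋃ w ∈ {w : Site 2 | ((N : ℤ) * a k ≤ w k ∧ w k ≤ (N : ℤ) * a k + 2 * (N : ℤ)) ∧
            ∀ j : Fin 2, j ≠ k → (N : ℤ) * a j ≤ w j ∧ w j ≤ (N : ℤ) * a j + (N : ℤ)},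
          armPairs (planeEmb 3 w) n) ∧
      (⋃ w ∈ {w : Site 2 | ((N : ℤ) * a k ≤ w k ∧ w k ≤ (N : ℤ) * a k + 2 * (N : ℤ)) ∧
            ∀ j : Fin 2, j ≠ k → (N : ℤ) * a j ≤ w j ∧ w j ≤ (N : ℤ) * a j + (N : ℤ)},
          armPairs (planeEmb 3 w) n).Finite) →
    ∀ (n N : ℕ), 2 * n < N → ∃ FPT : Sym2 (Site 2) → Set (Sym2 (Site 3)),
      (∀ e : Sym2 (Site 2), DeterminedBy {ω : BondConfig (Site 3) | e ∈
        {e : Sym2 (Site 2) | ∃ (a : Site 2) (k : Fin 2), e = s(a, a + Pi.single k 1) ∧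
          (∃ x y : Site 2, x k = (N : ℤ) * a k ∧ y k = (N : ℤ) * a k + 2 * (N : ℤ) ∧
            PathIn (zdGraph 2) ({w : Site 2 | ((N : ℤ) * a k ≤ w k ∧ w k ≤ (N : ℤ) * a k + 2 * (N : ℤ)) ∧
              ∀ j : Fin 2, j ≠ k → (N : ℤ) * a j ≤ w j ∧ w j ≤ (N : ℤ) * a j + (N : ℤ)} ∩
              {w | planeEmb 3 w ∈ quietSet n ω}) x y) ∧
          ∀ j : Fin 2, j ≠ k →
            (∃ x y : Site 2, x j = (N : ℤ) * a j ∧ y j = (N : ℤ) * a j + 2 * (N : ℤ) ∧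
              PathIn (zdGraph 2) ({w : Site 2 | ((N : ℤ) * a j ≤ w j ∧ w j ≤ (N : ℤ) * a j + 2 * (N : ℤ)) ∧
                ∀ i : Fin 2, i ≠ j → (N : ℤ) * a i ≤ w i ∧ w i ≤ (N : ℤ) * a i + (N : ℤ)} ∩
                {w | planeEmb 3 w ∈ quietSet n ω}) x y) ∧
            (∃ x y : Site 2, x j = (N : ℤ) * (a + Pi.single k 1 : Site 2) j ∧ y j = (N : ℤ) * (a + Pi.single k 1 : Site 2) j + 2 * (N : ℤ) ∧
              PathIn (zdGraph 2) ({w : Site 2 | ((N : ℤ) * (a + Pi.single k 1 : Site 2) j ≤ w j ∧ w j ≤ (N : ℤ) * (a + Pi.single k 1 : Site 2) j + 2 * (N : ℤ)) ∧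
                ∀ i : Fin 2, i ≠ j → (N : ℤ) * (a + Pi.single k 1 : Site 2) i ≤ w i ∧ w i ≤ (N : ℤ) * (a + Pi.single k 1 : Site 2) i + (N : ℤ)} ∩
                {w | planeEmb 3 w ∈ quietSet n ω}) x y)}} (FPT e) ∧ (FPT e).Finite) ∧
      ∀ e₁ e₂ : Sym2 (Site 2), (∀ b₁ ∈ e₁, ∀ b₂ ∈ e₂, ((5 : ℕ) : ℤ) ≤ max |b₁ 0 - b₂ 0| |b₁ 1 - b₂ 1|) →
        Disjoint (FPT e₁) (FPT e₂) := by
  intro hLoc n N hN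
  exact CoarseFootprint.exists_footprint (hLoc n N)
    (CoarseFootprint.exists_window_of_mem_footprint n N) hN

end Summit.CriticalPhenomena.PercolationContinuityZ3.Theorems

end
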